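import Literature.Computability.Complexity.ScaledPCPQueriesN
import Literature.Computability.Complexity.TableauCSPEvalFP
import HarnessLib

/-!
# The query map of the scaled PCP verifier is polynomial time

Literature / complexity toolkit, fourth MACHINE-LAYER brick for `ScaledPCP.verifier' M T`
(`ScaledPCPVerifier.lean`): the residue-level query list `queriesN` of `ScaledPCPQueriesN.lean`
(`= queriesOf`, `queriesOf_eq_queriesN`) is assembled in the typed algebra `CodeFP` from the
parameter programmes (`ScaledPCPParamsFP.lean`), the unary loop bounds and the tape slices
(`ScaledPCPTapeFP.lean`), the parse of the coins (`CodeFP.coinParseCode`, `CodeFPFieldSetup.lean`)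
and the read-address programmes (`TabEval.addrsNC`, `TabEval.descsC`, `TableauCSPEvalFP.lean`):

* generic lifts off the input pair `(x, ρ)` through any carrier (`ofLen`, the parameters `pI`, …,
  the tape `tvI`, the flag `flagI`, the slices `rNI`, `testXI`, …);
* `linPtI`, `vecIdxNC`/`vecIdxI`, `addrsFlatI`, `rdPtI`, `ldtI`, `scI`, `ptQI`, `sIdxI`, `msgQI`,
  `queriesNC`, and **`queriesC : CodeFP (pairE strE strE) (listE natE) (fun t => queriesOf M T t.1 t.2)`**
  under `CodeFP unE natE T` and `T n ≤ 2^{c_T n + c_T}`.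

All proved; no named fact.

## References

* L. Babai, L. Fortnow, L. Levin, M. Szegedy, *Checking computations in polylogarithmic time*,
  STOC 1991, §5 (the verifier runs in polynomial time) [BFLS1991].
* S. Arora, B. Barak, *Computational Complexity: A Modern Approach*, CUP 2009, Def. 11.4, §1.3
  [AroraBarakCC2009].
-/

noncomputable section

open Finset Polynomial

namespace Literature.Computability.Complexity

namespace ScaledPCP

open CodeFP Turing Tableau TableauCSP AlgebraicPCP LowDegreeTest ModArith TabEval _root_.Computability

attribute [local instance] Turing.FinTM2.kFin Turing.FinTM2.ΛFin Turing.FinTM2.σFin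
  Turing.FinTM2.Γk₀Fin

section FP

variable (M : TM2ComputableAux Bool Bool) (T : ℕ → ℕ) (hTc : CodeFP unE natE T) (cT : ℕ) (hTb : ∀ n, T n ≤ 2 ^ (cT * n + cT))
variable {κ : Type} {eκ : κ → List Bool} {X : κ → List Bool × List Bool}

local notation "inE" => pairE strE strE
local notation "d" => dM M

/-! ### Parameters off the input pair, through any carrier -/

/-- A unary-input programme off the length of `x`. [folklore] -/
theorem ofLen {β : Type} {e : β → List Bool} {f : ℕ → β} (hf : CodeFP unE e f) (hX : CodeFP eκ inE X) :
    CodeFP eκ e (fun k => f (X k).1.length) := (hf.comp (strLength.comp hX.fst')).congr fun _ => rfl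

include hTb in
omit hTc in
/-- Below `U`, below the budget. [folklore] -/
theorem le_WW_of_le_UU {n a : ℕ} (ha : a ≤ UU M cT n) : a ≤ WW M cT n := by
  have h1 : UU M cT n ≤ UU M cT n ^ 7 := by
    calc UU M cT n = UU M cT n ^ 1 := (pow_one _).symm
      _ ≤ UU M cT n ^ 7 := Nat.pow_le_pow_right (c0_le_UU M cT n).2 (by norm_num)
  have := hTb 0
  unfold WW; omega

include hTb in
omit hTc in
/-- `h` in unary. [folklore] -/
theorem hNU : CodeFP unE unE (hN M) := unaryOf M cT (hNC M) fun n => le_WW_of_le_UU M T cT hTb (hN_le_UU M cT n)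

include hTc hTb in
/-- `kt` in unary. [folklore] -/
theorem ktNU : CodeFP unE unE (ktN M T) := unaryOf M cT (ktNC M T hTc) fun n => le_WW_of_le_UU M T cT hTb (ktN_le_UU M T cT hTb n)

include hTc hTb in
/-- `kJ` in unary. [folklore] -/
theorem kJNU : CodeFP unE unE (kJN M T) := unaryOf M cT (kJNC M T hTc) fun n => le_WW_of_le_UU M T cT hTb (kJN_le_UU M T cT hTb n)

include hTc hTb in
/-- `d + 1` in unary. [folklore] -/
theorem dN1U : CodeFP unE unE (fun n => dN M T n + 1) :=
  unaryOf M cT (natAdd.comp ((dNC M T hTc).pair (CodeFP.const _ 1))) fun n => by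
    have := (params_le_WW M T cT hTb n).2.2.1; omega

include hTc hTb in
/-- **The parse of the coins** off the input pair. [folklore] -/
theorem parseI (hX : CodeFP eκ inE X) :
    CodeFP eκ (pairE bitE (rawE natE)) (fun k => coinParse (bN M T (X k).1.length) (pN M T (X k).1.length) (kT M T (X k).1) (X k).2) :=
  (coinParseCode.comp (((ofLen (kFU M T hTc cT hTb) hX).pair (ofLen (bNU M T hTc cT hTb) hX)).pair
    (hX.snd'.pair (ofLen (pNC M T hTc cT hTb) hX)))).congr fun k => by
      dsimp only
      rw [kF_eq]

include hTc hTb in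
/-- **The residue tape** off the input pair. [folklore] -/
theorem tvI (hX : CodeFP eκ inE X) : CodeFP eκ (rawE natE) (fun k => tvOf M T (X k).1 (X k).2) := (parseI M T hTc cT hTb hX).snd'

include hTc hTb in
/-- `r` off the input pair. [folklore] -/
theorem rNI (hX : CodeFP eκ inE X) : CodeFP eκ (rawE natE) (fun k => rN (KN M T (X k).1.length) (tvOf M T (X k).1 (X k).2)) :=
  (rNC.comp ((ofLen (KNU M T hTc cT hTb) hX).pair (tvI M T hTc cT hTb hX))).congr fun _ => rfl

include hTc hTb in
/-- `ρ` off the input pair. [folklore] -/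
theorem rhoNI (hX : CodeFP eκ inE X) : CodeFP eκ (rawE natE) (fun k => rhoN (KN M T (X k).1.length) (tvOf M T (X k).1 (X k).2)) :=
  (rhoNC.comp ((ofLen (KNU M T hTc cT hTb) hX).pair (tvI M T hTc cT hTb hX))).congr fun _ => rfl

include hTc hTb in
/-- The seed off the input pair. [folklore] -/
theorem seedNI (hX : CodeFP eκ inE X) : CodeFP eκ natE (fun k => seedN (KN M T (X k).1.length) (tvOf M T (X k).1 (X k).2)) :=
  (seedNC.comp ((ofLen (KNU M T hTc cT hTb) hX).pair (tvI M T hTc cT hTb hX))).congr fun _ => rfl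

include hTc hTb in
/-- Base point of a computed test index. [folklore] -/
theorem testXI (hX : CodeFP eκ inE X) {I : κ → ℕ} (hI : CodeFP eκ natE I) :
    CodeFP eκ (rawE natE) (fun k => testX (KN M T (X k).1.length) (mN M T (X k).1.length) (tvOf M T (X k).1 (X k).2) (I k)) :=
  (testXC.comp (((ofLen (KNU M T hTc cT hTb) hX).pair (ofLen (mNU M T hTc cT hTb) hX)).pair ((tvI M T hTc cT hTb hX).pair hI))).congr
    fun _ => rfl

include hTc hTb in
/-- Direction of a computed test index. [folklore] -/
theorem testTI (hX : CodeFP eκ inE X) {I : κ → ℕ} (hI : CodeFP eκ natE I) :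
    CodeFP eκ (rawE natE) (fun k => testT (KN M T (X k).1.length) (mN M T (X k).1.length) (tvOf M T (X k).1 (X k).2) (I k)) :=
  (testTC.comp (((ofLen (KNU M T hTc cT hTb) hX).pair (ofLen (mNU M T hTc cT hTb) hX)).pair ((tvI M T hTc cT hTb hX).pair hI))).congr
    fun _ => rfl

include hTc hTb in
/-- Direction of a computed read index. [folklore] -/
theorem dirNI (hX : CodeFP eκ inE X) {I : κ → ℕ} (hI : CodeFP eκ natE I) :
    CodeFP eκ (rawE natE) (fun k => dirN (KN M T (X k).1.length) (mN M T (X k).1.length) (TtN M T (X k).1.length)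
      (tvOf M T (X k).1 (X k).2) (I k)) :=
  (dirNC.comp (((ofLen (KNU M T hTc cT hTb) hX).pair ((ofLen (mNU M T hTc cT hTb) hX).pair (ofLen (TtNU M T hTc cT hTb) hX))).pair
    ((tvI M T hTc cT hTb hX).pair hI))).congr fun _ => rfl

/-! ### Points on lines, indices -/

/-- **`linPtN` of computed data.** [folklore] -/
theorem linPtI {P J : κ → ℕ} {A C : κ → List ℕ} (hP : CodeFP eκ natE P) (hA : CodeFP eκ (rawE natE) A) (hC : CodeFP eκ (rawE natE) C)
    (hJ : CodeFP eκ natE J) : CodeFP eκ (rawE natE) (fun k => linPtN (P k) (A k) (C k) (J k)) := by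
  have hg : CodeFP (pairE (pairE natE natE) (pairE natE natE)) natE (fun s => addM s.1.1 s.2.1 (mulM s.1.1 s.1.2 s.2.2)) :=
    modAdd (CodeFP.fst _ _).fst' (CodeFP.snd _ _).fst' (modMul (CodeFP.fst _ _).fst' (CodeFP.fst _ _).snd' (CodeFP.snd _ _).snd')
  exact ((CodeFP.zipWith hg).comp ((hP.pair hJ).pair (hA.pair hC))).congr fun k => rfl

/-- **`vecIdxN` off `(p, w)`.** [folklore] -/
theorem vecIdxNC : CodeFP (pairE natE (rawE natE)) natE (fun t => vecIdxN t.1 t.2) := by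
  -- context `(p, 1^{|w|})`, item `(t, a)`
  have hI : CodeFP (pairE (pairE natE unE) (pairE natE natE)) natE (fun s => s.2.2 * s.1.1 ^ min s.2.1 s.1.2) :=
    natMul.comp ((CodeFP.snd _ _).snd'.pair (natPow.comp ((CodeFP.fst _ _).fst'.pair (unOfNatMin.comp ((CodeFP.fst _ _).snd'.pair
      (CodeFP.snd _ _).fst')))))
  have hm := CodeFP.map hI
  refine ((natSum.comp (hm.comp (((CodeFP.fst _ _).pair ((ulength natE).comp (CodeFP.snd _ _))).pair
    ((rawEnum natE).comp (CodeFP.snd _ _))))).congr fun t => ?_)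
  unfold vecIdxN
  dsimp only
  congr 1
  apply List.map_congr_left
  intro ta hta
  have := List.mem_range.1 (List.of_mem_zip hta).1
  rw [min_eq_left this.le]

/-- `vecIdxN` of computed data. [folklore] -/
theorem vecIdxI {P : κ → ℕ} {W : κ → List ℕ} (hP : CodeFP eκ natE P) (hW : CodeFP eκ (rawE natE) W) :
    CodeFP eκ natE (fun k => vecIdxN (P k) (W k)) := (vecIdxNC.comp (hP.pair hW)).congr fun _ => rfl

/-! ### The read addresses and their residues -/

include hTc hTb in
/-- **The flattened table of read addresses** off the input pair. [cite: BFLS1991, §5] -/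
theorem addrsFlatI (hX : CodeFP eκ inE X) : CodeFP eκ (rawE (rawE natE)) (fun k => addrsFlat M T (X k).1 (tvOf M T (X k).1 (X k).2)) := by
  have hk : CodeFP eκ hkE (fun k => (hN M (X k).1.length, ktN M T (X k).1.length, kJN M T (X k).1.length)) :=
    (ofLen (hNU M T cT hTb) hX).pair ((ofLen (ktNU M T hTc cT hTb) hX).pair (ofLen (kJNU M T hTc cT hTb) hX))
  have hds : CodeFP eκ (rawE fdE) (fun k => descs M (X k).1.length 0 (T (X k).1.length) (X k).1) :=
    (descsC M).comp ((((natOfUn.comp strLength).comp hX.fst').pair ((CodeFP.const _ 0).pair (ofLen hTc hX))).pair hX.fst')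
  exact ((CodeFP.flatten (rawE natE)).comp (addrsNC.comp (hk.pair ((rNI M T hTc cT hTb hX).pair hds)))).congr fun k => rfl

include hTc hTb in
/-- **The residues of a computed read index.** [folklore] -/
theorem rdPtI (hX : CodeFP eκ inE X) {I : κ → ℕ} (hI : CodeFP eκ natE I) :
    CodeFP eκ (rawE natE) (fun k => rdPtN M T (X k).1 (tvOf M T (X k).1 (X k).2) (I k)) := by
  -- context `(p, row)`, item `u`
  have hrow : CodeFP eκ (rawE natE) (fun k => (addrsFlat M T (X k).1 (tvOf M T (X k).1 (X k).2)).getD (I k) []) :=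
    ((rawGetD (rawE natE) (rawE_nil natE)).comp ((addrsFlatI M T hTc cT hTb hX).pair hI)).congr fun _ => rfl
  have hJ : CodeFP (pairE (pairE natE (rawE natE)) natE) natE (fun s => s.1.2.getD s.2 0 % s.1.1) :=
    natMod.comp (((rawGetD natE natE_zero).comp ((CodeFP.fst _ _).snd'.pair (CodeFP.snd _ _))).pair (CodeFP.fst _ _).fst')
  exact ((CodeFP.map hJ).comp ((((ofLen (pNC M T hTc cT hTb) hX)).pair hrow).pair (urange.comp (ofLen (mNU M T hTc cT hTb) hX)))).congr
    fun k => rfl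

/-! ### The point lists -/

include hTc hTb in
/-- **The test points** off the input pair. [cite: RubinfeldSudan1996, §4] -/
theorem ldtI (hX : CodeFP eκ inE X) : CodeFP eκ (rawE (rawE natE)) (fun k => ldtN M T (X k).1 (tvOf M T (X k).1 (X k).2)) := by
  -- outer item `i`, inner item `j`; carrier `((k, i), j)`
  have hX2 : CodeFP (pairE (pairE eκ natE) natE) inE (fun s => X s.1.1) := hX.comp (CodeFP.fst _ _).fst'
  have hIn : CodeFP (pairE (pairE eκ natE) natE) (rawE natE) (fun s => linPtN (pN M T (X s.1.1).1.length)
      (testX (KN M T (X s.1.1).1.length) (mN M T (X s.1.1).1.length) (tvOf M T (X s.1.1).1 (X s.1.1).2) s.1.2)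
      (testT (KN M T (X s.1.1).1.length) (mN M T (X s.1.1).1.length) (tvOf M T (X s.1.1).1 (X s.1.1).2) s.1.2) s.2) :=
    linPtI (ofLen (pNC M T hTc cT hTb) hX2) (testXI M T hTc cT hTb hX2 (CodeFP.fst _ _).snd') (testTI M T hTc cT hTb hX2 (CodeFP.fst _ _).snd')
      (CodeFP.snd _ _)
  have hX1 : CodeFP (pairE eκ natE) inE (fun s => X s.1) := hX.comp (CodeFP.fst _ _)
  have hOut := (CodeFP.map hIn).comp ((CodeFP.id _).pair (urange.comp (ofLen (dN2U M T hTc cT hTb) hX1)))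
  exact ((CodeFP.flatten (rawE natE)).comp ((CodeFP.map hOut).comp ((CodeFP.id _).pair (urange.comp (ofLen (TtNU M T hTc cT hTb) hX))))).congr
    fun k => rfl

include hTc hTb in
/-- **The self-correction points** off the input pair. [cite: AroraBarakCC2009, §8.6.2] -/
theorem scI (hX : CodeFP eκ inE X) : CodeFP eκ (rawE (rawE natE)) (fun k => scN M T (X k).1 (tvOf M T (X k).1 (X k).2)) := by
  have hX2 : CodeFP (pairE (pairE eκ natE) natE) inE (fun s => X s.1.1) := hX.comp (CodeFP.fst _ _).fst'
  have hIn : CodeFP (pairE (pairE eκ natE) natE) (rawE natE) (fun s => linPtN (pN M T (X s.1.1).1.length)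
      (rdPtN M T (X s.1.1).1 (tvOf M T (X s.1.1).1 (X s.1.1).2) s.1.2)
      (dirN (KN M T (X s.1.1).1.length) (mN M T (X s.1.1).1.length) (TtN M T (X s.1.1).1.length) (tvOf M T (X s.1.1).1 (X s.1.1).2) s.1.2)
      (s.2 + 1)) :=
    linPtI (ofLen (pNC M T hTc cT hTb) hX2) (rdPtI M T hTc cT hTb hX2 (CodeFP.fst _ _).snd') (dirNI M T hTc cT hTb hX2 (CodeFP.fst _ _).snd')
      (natAdd.comp ((CodeFP.snd _ _).pair (CodeFP.const _ 1)))
  have hX1 : CodeFP (pairE eκ natE) inE (fun s => X s.1) := hX.comp (CodeFP.fst _ _)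
  have hOut := (CodeFP.map hIn).comp ((CodeFP.id _).pair (urange.comp (ofLen (dN1U M T hTc cT hTb) hX1)))
  exact ((CodeFP.flatten (rawE natE)).comp ((CodeFP.map hOut).comp ((CodeFP.id _).pair (urange.comp (ofLen (nQryU M T cT hTb) hX))))).congr
    fun k => rfl

include hTc hTb in
/-- **The bit positions of a computed point list.** [folklore] -/
theorem ptQI (hX : CodeFP eκ inE X) {Ps : κ → List (List ℕ)} (hPs : CodeFP eκ (rawE (rawE natE)) Ps) :
    CodeFP eκ (rawE natE) (fun k => ptQN M T (X k).1 (Ps k)) := by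
  -- carrier `((k, w), i)`
  have hX2 : CodeFP (pairE (pairE eκ (rawE natE)) natE) inE (fun s => X s.1.1) := hX.comp (CodeFP.fst _ _).fst'
  have hIn : CodeFP (pairE (pairE eκ (rawE natE)) natE) natE
      (fun s => vecIdxN (pN M T (X s.1.1).1.length) s.1.2 * b0 M T (X s.1.1).1.length + s.2) :=
    natAdd.comp ((natMul.comp ((vecIdxI (ofLen (pNC M T hTc cT hTb) hX2) (CodeFP.fst _ _).snd').pair (ofLen (b0C M T hTc cT hTb) hX2))).pair
      (CodeFP.snd _ _))
  have hX1 : CodeFP (pairE eκ (rawE natE)) inE (fun s => X s.1) := hX.comp (CodeFP.fst _ _)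
  have hOut := (CodeFP.map hIn).comp ((CodeFP.id _).pair (urange.comp (ofLen (b0U M T hTc cT hTb) hX1)))
  exact ((CodeFP.flatten natE).comp ((CodeFP.map hOut).comp ((CodeFP.id _).pair hPs))).congr fun k => rfl

/-! ### The message positions -/

include hTc hTb in
/-- **The index of a computed message argument.** [folklore] -/
theorem sIdxI (hX : CodeFP eκ inE X) {I : κ → ℕ} (hI : CodeFP eκ natE I) :
    CodeFP eκ natE (fun k => sIdxN M T (X k).1 (tvOf M T (X k).1 (X k).2) (I k)) := by
  have hp := ofLen (pNC M T hTc cT hTb) hX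
  have hK : CodeFP eκ natE (fun k => KN M T (X k).1.length) := ofLen (KNC M T hTc) hX
  have h1 : CodeFP eκ natE (fun k => vecIdxN (pN M T (X k).1.length) (rhoN (KN M T (X k).1.length) (tvOf M T (X k).1 (X k).2))) :=
    (vecIdxI hp (rhoNI M T hTc cT hTb hX)).congr fun _ => rfl
  have hpref : CodeFP eκ (rawE natE) (fun k => (rN (KN M T (X k).1.length) (tvOf M T (X k).1 (X k).2)).take (I k)) :=
    ((rawTakeNat natE).comp (hI.pair (rNI M T hTc cT hTb hX))).congr fun _ => rfl
  have h2 : CodeFP eκ natE (fun k => vecIdxN (pN M T (X k).1.length) ((rN (KN M T (X k).1.length) (tvOf M T (X k).1 (X k).2)).take (I k))) :=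
    (vecIdxI hp hpref).congr fun _ => rfl
  -- (the `congr` steps below are closed by `dsimp only`: a bare `rfl` would make the unifier unfold
  -- the recursive argument of `+`/`^`, i.e. the parameters themselves)
  have hA : CodeFP eκ natE (fun k => (vecIdxN (pN M T (X k).1.length) (rhoN (KN M T (X k).1.length) (tvOf M T (X k).1 (X k).2)) *
      pN M T (X k).1.length + seedN (KN M T (X k).1.length) (tvOf M T (X k).1 (X k).2)) * (KN M T (X k).1.length + 1) + I k) :=
    (natAdd.comp ((natMul.comp ((natAdd.comp ((natMul.comp (h1.pair hp)).pair (seedNI M T hTc cT hTb hX))).pair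
      (natAdd.comp (hK.pair (CodeFP.const _ 1))))).pair hI)).congr fun _ => by dsimp only
  have hB : CodeFP eκ natE (fun k => pN M T (X k).1.length ^ KN M T (X k).1.length) :=
    (natPow.comp (hp.pair (ofLen (KNU M T hTc cT hTb) hX))).congr fun _ => by dsimp only
  exact (natAdd.comp ((natMul.comp (hA.pair hB)).pair h2)).congr fun k => by unfold sIdxN; dsimp only

include hTc hTb in
/-- **The message positions** off the input pair. [folklore] -/
theorem msgQI (hX : CodeFP eκ inE X) : CodeFP eκ (rawE natE) (fun k => msgQN M T (X k).1 (tvOf M T (X k).1 (X k).2)) := by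
  -- carrier `(((k, i), j), i')`
  have hX3 : CodeFP (pairE (pairE (pairE eκ natE) natE) natE) inE (fun s => X s.1.1.1) := hX.comp (CodeFP.fst _ _).fst'.fst'
  have hb0 := ofLen (b0C M T hTc cT hTb) hX3
  have hIn : CodeFP (pairE (pairE (pairE eκ natE) natE) natE) natE (fun s =>
      baseS M T (X s.1.1.1).1.length + (sIdxN M T (X s.1.1.1).1 (tvOf M T (X s.1.1.1).1 (X s.1.1.1).2) s.1.1.2 * (DN M T (X s.1.1.1).1.length + 1)
        + s.1.2) * b0 M T (X s.1.1.1).1.length + s.2) := by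
    refine (natAdd.comp ((natAdd.comp ((natMul.comp ((natPow.comp ((ofLen (pNC M T hTc cT hTb) hX3).pair (ofLen (mNU M T hTc cT hTb) hX3))).pair
      hb0)).pair (natMul.comp ((natAdd.comp ((natMul.comp ((sIdxI M T hTc cT hTb hX3 (CodeFP.fst _ _).fst'.snd').pair
      (natAdd.comp ((ofLen (DNC M T hTc) hX3).pair (CodeFP.const _ 1))))).pair (CodeFP.fst _ _).snd')).pair hb0)))).pair (CodeFP.snd _ _))).congr
      fun s => ?_
    unfold baseS; rfl
  have hX2 : CodeFP (pairE (pairE eκ natE) natE) inE (fun s => X s.1.1) := hX.comp (CodeFP.fst _ _).fst'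
  have hX1 : CodeFP (pairE eκ natE) inE (fun s => X s.1) := hX.comp (CodeFP.fst _ _)
  have hL3 := (CodeFP.map hIn).comp ((CodeFP.id _).pair (urange.comp (ofLen (b0U M T hTc cT hTb) hX2)))
  have hL2 := (CodeFP.flatten natE).comp ((CodeFP.map hL3).comp ((CodeFP.id _).pair (urange.comp (ofLen (DN1U M T hTc cT hTb) hX1))))
  exact ((CodeFP.flatten natE).comp ((CodeFP.map hL2).comp ((CodeFP.id _).pair (urange.comp (ofLen (KNU M T hTc cT hTb) hX))))).congr
    fun k => rfl

/-! ### The query list -/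

include hTc hTb in
/-- **The residue-level query list off the input pair.** [cite: BFLS1991, §5] -/
theorem queriesNC : CodeFP inE (rawE natE) (fun t => queriesN M T t.1 t.2) := by
  have hX : CodeFP inE inE (fun t => t) := CodeFP.id _
  have hpts : CodeFP inE (rawE (rawE natE)) (fun t => ptsN M T t.1 (tvOf M T t.1 t.2)) :=
    ((rawAppend (rawE natE)).comp ((ldtI M T hTc cT hTb hX).pair (scI M T hTc cT hTb hX))).congr fun t => rfl
  have hyes : CodeFP inE (rawE natE) (fun t => ptQN M T t.1 (ptsN M T t.1 (tvOf M T t.1 t.2)) ++ msgQN M T t.1 (tvOf M T t.1 t.2)) :=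
    ((rawAppend natE).comp ((ptQI M T hTc cT hTb hX hpts).pair (msgQI M T hTc cT hTb hX))).congr fun _ => rfl
  exact ((CodeFP.ite (parseI M T hTc cT hTb hX).fst' hyes (CodeFP.const _ [])).congr fun t => by unfold queriesN; rfl)

include hTc hTb in
/-- **The query map of the scaled PCP verifier is polynomial time.** [cite: BFLS1991, §5]
[cite: AroraBarakCC2009, Def. 11.4] -/
theorem queriesC : CodeFP inE (listE natE) (fun t => queriesOf M T t.1 t.2) :=
  ((listOfRaw natE).comp (queriesNC M T hTc cT hTb)).congr fun t => by
    show queriesN M T t.1 t.2 = queriesOf M T t.1 t.2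
    rw [queriesOf_eq_queriesN]

end FP

end ScaledPCP

end Literature.Computability.Complexity

end
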